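import Mathlib.GroupTheory.Transfer
import Mathlib.GroupTheory.Index
import Mathlib.Algebra.Field.Basic
import HarnessLib

set_option autoImplicit false
set_option linter.dupNamespace false

/-!
# The abstract extension engines of the `C₃`-residual line (es g12, MEMO-es §25.9/§25.11): transfer on stable classes,
# extension of a stable character across an index invertible in the coefficients (EXT-ODD), and across index `2` with a
# prescribed value (EXT-TWO)

Summit `BirchSwinnertonDyer`, route `ManinLocalTwoThree` (cell bsd-f2-manin), deciding crux C2 `ManinOddAtFour`
(stmt-BirchSwinnertonDyer-22967), skeleton `kato_shift_two` v6, stub 3 `stub_cThreeImageResidual`.  Pure group theory (Mathlib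
`MonoidHom.transfer`), the es planner's HOME/es/ExtLemmas-es-g12.lean (708a94fef77c2592, farm rc 0) landed VERBATIM by the lead
(the one `def ExtTwo : Prop` unfolded into the statement of `extTwo`, no definitions):
* `transfer_eq_pow_of_stable` — `Ver(ϕ)(g) = ϕ(g)^{(G:H)}` for `g ∈ H` when `ϕ` is STABLE (Cartan–Eilenberg, `cor ∘ res =
  index` on stable classes; Mathlib's `MonoidHom.transfer_eq_pow` needs the element identity `g₀⁻¹gᵏg₀ = gᵏ`);
* `exists_extension_of_stable_of_index_invertible` (EXT-ODD) — a `G`-stable character `H → (K,+)` of a finite-index subgroup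
  with index invertible in `K` extends to `G` (`(G:H)⁻¹ · Ver`): the index-`3` step of the `t = 2` vertex and the odd-index
  descents of §25.11;
* `extTwo` (EXT-TWO) — index `2`, prescribed value `y` with `2y = ψ(g²)`, existence AND uniqueness: E-es-37 and the `C₂`-step
  of the `t = 2` vertex.
Nothing about BSD or Manin's conjecture is proved here.  References: H. Cartan, S. Eilenberg, *Homological Algebra* XII §8
(transfer); HOME/MEMO-es.md §25.9, §25.11.
-/

namespace Summit.BirchSwinnertonDyer.BirchSwinnertonDyer.Theorems.ManinLocalTwoThree

open MulAction Subgroup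

variable {G : Type*} [Group G] {H : Subgroup G} {A : Type*} [CommGroup A]

/-- **`Ver(ϕ)(g) = ϕ(g)^{(G:H)}` for `g ∈ H` and `ϕ` stable** (only values of `ϕ` are compared, not elements). -/
theorem transfer_eq_pow_of_stable [H.FiniteIndex] (ϕ : H →* A) (g : H)
    (key : ∀ (k : ℕ) (g₀ : G) (hk : g₀⁻¹ * (g : G) ^ k * g₀ ∈ H), ϕ ⟨g₀⁻¹ * (g : G) ^ k * g₀, hk⟩ = ϕ (g ^ k)) :
    MonoidHom.transfer ϕ (g : G) = ϕ g ^ H.index := by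
  classical
  letI := H.fintypeQuotientOfFiniteIndex
  rw [MonoidHom.transfer_eq_prod_quotient_orbitRel_zpowers_quot,
    Fintype.prod_congr _ (fun q => ϕ g ^ Function.minimalPeriod (((g : G)) • ·) q.out)
      (fun q => by rw [key, map_pow]),
    Finset.prod_pow_eq_pow_sum, ← Subgroup.index_eq_sum_minimalPeriod]

/-- **EXT-ODD.** A `G`-stable character `ψ : H → (K, +)` of a finite-index subgroup whose index is invertible in `K`
extends to a character of `G` (namely `(G:H)⁻¹ · Ver(ψ)`). -/
theorem exists_extension_of_stable_of_index_invertible [H.FiniteIndex] {K : Type*} [Field K]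
    (ψ : H →* Multiplicative K)
    (key : ∀ (h : H) (g₀ : G) (hk : g₀⁻¹ * (h : G) * g₀ ∈ H), ψ ⟨g₀⁻¹ * (h : G) * g₀, hk⟩ = ψ h)
    (hm : (H.index : K) ≠ 0) :
    ∃ Ψ : G →* Multiplicative K, ∀ h : H, Ψ h = ψ h := by
  classical
  let V : G →* Multiplicative K := MonoidHom.transfer ψ
  let s : Multiplicative K →* Multiplicative K :=
    { toFun := fun x => Multiplicative.ofAdd ((H.index : K)⁻¹ * Multiplicative.toAdd x)
      map_one' := by simp
      map_mul' := fun x y => by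
        rw [← ofAdd_add, toAdd_mul, mul_add] }
  refine ⟨s.comp V, fun h => ?_⟩
  have hV : V h = ψ h ^ H.index := by
    refine transfer_eq_pow_of_stable ψ h fun k g₀ hk => ?_
    have := key (h ^ k) g₀ (by simpa using hk)
    simpa using this
  simp only [MonoidHom.comp_apply, hV, s, MonoidHom.coe_mk, OneHom.coe_mk, toAdd_pow, nsmul_eq_mul]
  rw [← mul_assoc, inv_mul_cancel₀ hm, one_mul, ofAdd_toAdd]

/-- **EXT-TWO** (index-2 extension with prescribed value; 4-case check using `Subgroup.mul_mem_iff_of_index_two`): `M` of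
index 2 in `G` (hence normal), `g ∉ M`, `ψ : M → (K,+)` a character stable under conjugation by `g`, and `y` with
`y + y = ψ(g²)`; then there is exactly one character `Ψ` of `G` extending `ψ` with `Ψ g = y` (explicit construction
`Ψ x = ψ x` on `M`, `Ψ x = y + ψ (g⁻¹ x)` off `M`).  es g12's engine for E-es-37 / the `t = 2` vertex step (MEMO-es §25.9),
HOME/es/ExtLemmas-es-g12.lean verbatim with the `def ExtTwo` unfolded into the statement. [folklore] -/
theorem extTwo :
    ∀ (G : Type) [Group G] (M : Subgroup G) (K : Type) [AddCommGroup K] (g : G) (hM : M.index = 2) (hg : g ∉ M)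
      (ψ : M → K), (∀ a b : M, ψ (a * b) = ψ a + ψ b) →
      (∀ (a : M) (ha : g⁻¹ * (a : G) * g ∈ M), ψ ⟨g⁻¹ * (a : G) * g, ha⟩ = ψ a) →
      ∀ y : K, y + y = ψ ⟨g * g, Subgroup.mul_self_mem_of_index_two hM g⟩ →
      ∃! Ψ : G → K, (∀ a b : G, Ψ (a * b) = Ψ a + Ψ b) ∧ Ψ g = y ∧ ∀ a : M, Ψ a = ψ a := by
  intro G _ M K _ g hM hg ψ hmul hstab y hy
  classical
  have two : ∀ {a b : G}, a * b ∈ M ↔ (a ∈ M ↔ b ∈ M) := fun {a b} =>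
    Subgroup.mul_mem_iff_of_index_two hM
  have hginv : g⁻¹ ∉ M := fun h => hg (by simpa using M.inv_mem h)
  -- membership bookkeeping
  have off : ∀ x : G, x ∉ M → g⁻¹ * x ∈ M := fun x hx => by
    rw [two]; exact ⟨fun h => (hginv h).elim, fun h => (hx h).elim⟩
  have conj : ∀ a : G, a ∈ M → g⁻¹ * a * g ∈ M := fun a ha => by
    rw [two, two]
    exact ⟨fun h => (hginv (h.mpr ha)).elim, fun h => (hg h).elim⟩
  have psi_one : ψ 1 = 0 := by
    have := hmul 1 1; rw [mul_one] at this
    -- ψ 1 = ψ 1 + ψ 1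
    have h2 : ψ 1 + ψ 1 = ψ 1 + 0 := by rw [add_zero]; exact this.symm
    exact add_left_cancel h2
  -- splitting lemma: value of ψ on a product of two members
  have split : ∀ (x m₁ m₂ : G) (hx : x ∈ M) (h₁ : m₁ ∈ M) (h₂ : m₂ ∈ M), x = m₁ * m₂ →
      ψ ⟨x, hx⟩ = ψ ⟨m₁, h₁⟩ + ψ ⟨m₂, h₂⟩ := by
    intro x m₁ m₂ hx h₁ h₂ e
    have : (⟨x, hx⟩ : M) = ⟨m₁, h₁⟩ * ⟨m₂, h₂⟩ := Subtype.ext (by simpa using e)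
    rw [this, hmul]
  let Ψ : G → K := fun x => if hx : x ∈ M then ψ ⟨x, hx⟩ else y + ψ ⟨g⁻¹ * x, off x hx⟩
  have hΨM : ∀ (x : G) (hx : x ∈ M), Ψ x = ψ ⟨x, hx⟩ := fun x hx => by simp [Ψ, hx]
  have hΨoff : ∀ (x : G) (hx : x ∉ M), Ψ x = y + ψ ⟨g⁻¹ * x, off x hx⟩ := fun x hx => by simp [Ψ, hx]
  have hΨg : Ψ g = y := by
    rw [hΨoff g hg]
    have : (⟨g⁻¹ * g, off g hg⟩ : M) = 1 := Subtype.ext (by simp)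
    rw [this, psi_one, add_zero]
  have hΨmul : ∀ a b : G, Ψ (a * b) = Ψ a + Ψ b := by
    intro a b
    by_cases ha : a ∈ M <;> by_cases hb : b ∈ M
    · -- both in M
      have hab : a * b ∈ M := M.mul_mem ha hb
      rw [hΨM _ hab, hΨM _ ha, hΨM _ hb]
      exact split _ _ _ hab ha hb rfl
    · -- a ∈ M, b ∉ M
      have hab : a * b ∉ M := fun h => hb ((two.mp h).mp ha)
      rw [hΨoff _ hab, hΨM _ ha, hΨoff _ hb, ← hstab ⟨a, ha⟩ (conj a ha)]
      rw [split (g⁻¹ * (a * b)) (g⁻¹ * a * g) (g⁻¹ * b) (off _ hab) (conj a ha) (off b hb) (by group)]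
      abel
    · -- a ∉ M, b ∈ M
      have hab : a * b ∉ M := fun h => ha ((two.mp h).mpr hb)
      rw [hΨoff _ hab, hΨoff _ ha, hΨM _ hb,
        split (g⁻¹ * (a * b)) (g⁻¹ * a) b (off _ hab) (off a ha) hb (by group)]
      abel
    · -- both off M
      have hab : a * b ∈ M := by
        rw [two]; exact ⟨fun h => (ha h).elim, fun h => (hb h).elim⟩
      have hag : a * g⁻¹ ∈ M := by
        rw [two]; exact ⟨fun h => (ha h).elim, fun h => (hginv h).elim⟩
      have hgg : g * g ∈ M := Subgroup.mul_self_mem_of_index_two hM g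
      -- stability at c := a g⁻¹ : ψ (g⁻¹ (a g⁻¹) g) = ψ (a g⁻¹), and g⁻¹ a g⁻¹ g = g⁻¹ a
      have hst := hstab ⟨a * g⁻¹, hag⟩ (conj _ hag)
      have e1 : (⟨g⁻¹ * (a * g⁻¹) * g, conj _ hag⟩ : M) = ⟨g⁻¹ * a, off a ha⟩ :=
        Subtype.ext (by group)
      rw [e1] at hst
      rw [hΨM _ hab, hΨoff _ ha, hΨoff _ hb,
        split (a * b) (a * g⁻¹ * (g * g)) (g⁻¹ * b) hab (M.mul_mem hag hgg) (off b hb) (by group),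
        split (a * g⁻¹ * (g * g)) (a * g⁻¹) (g * g) (M.mul_mem hag hgg) hag hgg rfl, ← hst, ← hy]
      abel
  refine ⟨Ψ, ⟨hΨmul, hΨg, fun a => by rw [hΨM a a.2]⟩, ?_⟩
  -- uniqueness
  rintro Ψ' ⟨h'mul, h'g, h'M⟩
  funext x
  by_cases hx : x ∈ M
  · rw [hΨM x hx]; exact h'M ⟨x, hx⟩
  · have e : x = g * (g⁻¹ * x) := by group
    have h1 : Ψ' x = Ψ' g + Ψ' (g⁻¹ * x) := by
      conv_lhs => rw [e]
      exact h'mul _ _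
    have h2 : Ψ' (g⁻¹ * x) = ψ ⟨g⁻¹ * x, off x hx⟩ := h'M ⟨g⁻¹ * x, off x hx⟩
    rw [hΨoff x hx, h1, h'g, h2]

end Summit.BirchSwinnertonDyer.BirchSwinnertonDyer.Theorems.ManinLocalTwoThree
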